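import Literature.MathematicalPhysics.QuantumFieldTheory.Balaban1983to89.Beta.BubbleTransfer

/-!
# `Balaban1983to89.Beta.FreeHessianLeg` — Lawler (1.37) DISCHARGED for the `k = 0` free background-field table:
the two-derivative free leg and an3's `stepBal_le_of_freeTable` with NO printed hypothesis

HONEST FRAMING (page 1 of everything in the pub-balaban BETA cell).  Discharging `FlowStep.BetaPertH` — the located,
UNPRINTED input of Bałaban's ultraviolet-stability theorem [Balaban1989LargeFieldII, Thm 1 p. 29], the perturbative
bounds (1.22)–(1.24) of [Balaban1989LargeFieldI, pp. 8–9] «to be published [21]», never published — would make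
Bałaban's UV stability UNCONDITIONAL, a real constructive-QFT result; it is NOT the continuum limit and NOT the Clay
problem.  THIS FILE PROVES NOTHING ABOUT BAŁABAN'S OPERATORS.  It removes the ONE printed hypothesis of the `k = 0` free
rung of the (1.22) window interface: `Beta.BubbleTransfer` (row BETA-an3, item (vi)) builds the free background-field leg
table at `k = 0` from the tree's lattice-Green-function asymptotics, CONDITIONALLY on three instances of the SHAPE
`Lawler137Shape y K` = [Lawler1991] Thm 1.5.5 (1.37) for the step vectors `y = e_μ, e_ν, e_μ + e_ν` («located, quoted,
not proved here», GAPS G-beta-an3-6 (c)).  With lit1's `LatticeModels.LatticeGreenGradient` v1.2 §5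
(`latticeGreen_second_diff_continuum`, `latticeGreen_second_diff_continuum_two` — (1.37) for `y = eᵢ` and
`y = eᵢ + eⱼ` in the printed continuum-derivative form, ALL `x ≠ 0`, general `d ≥ 3`, proved from the tree's
difference-LCLT) those three instances are THEOREMS at `d = 4`:

* `lawler137Shape_unitVec` — `∃ K ≥ 0, ∀ μ, Lawler137Shape (unitVec μ) K`;
* `lawler137Shape_unitVec_add` — `∃ K ≥ 0, ∀ μ ≠ ν, Lawler137Shape (unitVec μ + unitVec ν) K`;
* `lawler137` — one common constant for both families (`Lawler137Shape` is monotone in `K`);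
* `K137`, `mixedHessLeg₀ hμν` — the polarised two-derivative free leg `c₄∂_μ∂_ν|x|⁻²` of `BubbleTransfer` with its
  three shape binders DISCHARGED (`mixedHessLeg₀_ℓ`, `mixedHessLeg₀_a`);
* `hval_freeTable₀`, **`stepBal_le_of_freeTable₀`** — an3's `hval_freeTable` / `stepBal_le_of_freeTable` with the
  binders `hK h₁ h₂ h₃` gone: for any `β⁰`, window `M` with the comparability and the outside-window slot `A₁` relative
  to the FREE background-field table, `stepBal N L − A ≤ β⁰(L,k)` for all `L ≥ 2`, `k` — now with NO printed hypothesis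
  on the leg side.  What it still takes as INPUT is exactly what `BubbleTransfer` lists under «WHAT THIS FILE DOES NOT
  DO» (a)/(b): that Bałaban's `k = 0` integrand reduces to this table + the slot `A₁` (items (iii)–(v)); for `k ≥ 1`
  nothing here applies (the legs are the k-th effective propagators, rows an5/an1/an3-g5 `TwoPowerLegs`/`BlockLegs`).

Dictionary (all kernel, [folklore]): `a₄ = Γ(1)/(2π²) = 2c₄` (`BubbleTransfer.green_const_four`); `|x|₂^{−4} = 1/r2²`,
`|x|₂^{−6} = 1/r2³` on `ℤ⁴ ∖ 0`; the quadratic form `Σ_{kl} y_ky_l ∂_k∂_l|x|⁻² = 8(x·y)²/r2³ − 2|y|²/r2²`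
(`qf_hessInvSq`), so that lit1's `(2−d)(|y|²|x|^{−d} − d(x·y)²|x|^{−d−2})` at `d = 4` is `Σ_{kl}y_ky_l hessInvSq k l x`.

CITATION HEADER (cell ABSOLUTE RULE: the manuscripts under audit are context, never authority).
* [Balaban1989LargeFieldI] / [Balaban1989LargeFieldII] T. Bałaban, Large field renormalization. I / II, Comm. Math.
  Phys. 122 (1989) 175–202 / 355–392 — CONTEXT ONLY (where (1.22) and UV stability are stated).
* [Lawler1991] G. F. Lawler, Intersections of Random Walks, Birkhäuser 1991, doi:10.1007/978-1-4612-0771-9 — Thm 1.5.5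
  (1.37) [held text `book:lawler1991-intersections-random-walks` chunk p0021 L54–60], differences and (1.9) [chunk p0011
  L17–27].  Enters ONLY through the TREE theorems `LatticeModels.latticeGreen_second_diff_continuum{,_two}` (lit1-g6,
  `LatticeGreenGradient.lean` v1.2 §5); nothing is cited as a hypothesis in this file.
* Internal division of labour (NOT citations): BETA-SPEC.md v1.9g §6.12 OWNERS (vi) «k = 0 `Lawler137Shape` discharge from
  lit1 v1.1»; AN3.md; LIT1.md v1.9 §11.

Tags: [folklore] = elementary real analysis / algebra proved here, or a definition built from proved data.
No `axiom`, no `sorry`, no `Prop`-valued definition; every theorem's hypotheses are explicit binders.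
-/

noncomputable section

namespace Literature.MathematicalPhysics.QuantumFieldTheory.Balaban1983to89.Beta.FreeHessianLeg

open Finset
open Literature.Probability.LatticeModels (annulus latticeGreen Site)
open Literature.MathematicalPhysics.QuantumFieldTheory.Balaban1983to89
open Literature.MathematicalPhysics.QuantumFieldTheory.Balaban1983to89.Beta
open Literature.MathematicalPhysics.QuantumFieldTheory.Balaban1983to89.Beta.TransverseStructure
open Literature.MathematicalPhysics.QuantumFieldTheory.Balaban1983to89.Beta.LeadingCoefficient
open Literature.MathematicalPhysics.QuantumFieldTheory.Balaban1983to89.Beta.DyadicShell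
  (Pt toReal supNorm norm_toReal supNorm_pos)
open Literature.MathematicalPhysics.QuantumFieldTheory.Balaban1983to89.Beta.LargeLWindow (WindowDecomposition)
open Literature.MathematicalPhysics.QuantumFieldTheory.Balaban1983to89.Beta.BubbleTransfer

/-! ## §1. Dictionary `d = 4`: Euclidean powers and the Hessian quadratic form -/

/-- `|x|₂^{−6} = 1/r2³` on `ℤ⁴ ∖ 0`. [folklore] -/
theorem sqrt_rpow_neg_six {w : Pt} (hw : w ≠ 0) :
    Real.sqrt (∑ j, ((w j : ℤ) : ℝ) ^ 2) ^ (-(6 : ℝ)) = 1 / r2 (toReal w) ^ 3 := by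
  have hS : 0 < r2 (toReal w) := by
    have := supNorm_sq_le_r2 w
    have hs : (1 : ℝ) ≤ supNorm w := Leg.one_le_supNorm hw
    nlinarith
  rw [sum_sq_eq_r2, Real.rpow_neg (Real.sqrt_nonneg _), show (6 : ℝ) = ((6 : ℕ) : ℝ) by norm_num, Real.rpow_natCast,
    show Real.sqrt (r2 (toReal w)) ^ 6 = (Real.sqrt (r2 (toReal w)) ^ 2) ^ 3 by ring, Real.sq_sqrt hS.le, one_div]

/-- `(toReal x) k = x_k`. [folklore] -/
theorem toReal_apply (x : Pt) (k : Fin 4) : toReal x k = ((x k : ℤ) : ℝ) := rfl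

/-- **The Hessian quadratic form of `|x|⁻²` along a lattice vector**:
`Σ_{kl} y_ky_l ∂_k∂_l|x|⁻² = 8(x·y)²/r2³ − 2|y|²/r2²`. [folklore] -/
theorem qf_hessInvSq (x y : Pt) :
    ∑ k, ∑ l, ((y k : ℤ) : ℝ) * ((y l : ℤ) : ℝ) * hessInvSq k l (toReal x) =
      8 * (∑ k, ((x k : ℤ) : ℝ) * ((y k : ℤ) : ℝ)) ^ 2 / r2 (toReal x) ^ 3 -
        2 * (∑ k, ((y k : ℤ) : ℝ) ^ 2) / r2 (toReal x) ^ 2 := by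
  have h : ∀ k l, ((y k : ℤ) : ℝ) * ((y l : ℤ) : ℝ) * hessInvSq k l (toReal x) =
      8 / r2 (toReal x) ^ 3 * ((((x k : ℤ) : ℝ) * ((y k : ℤ) : ℝ)) * (((x l : ℤ) : ℝ) * ((y l : ℤ) : ℝ))) -
        (if k = l then 2 / r2 (toReal x) ^ 2 * ((y l : ℤ) : ℝ) ^ 2 else 0) := by
    intro k l
    simp only [hessInvSq, toReal_apply]
    split_ifs with hkl
    · subst hkl; ring
    · ring
  simp_rw [h]
  simp only [Finset.sum_sub_distrib, Finset.sum_ite_eq, Finset.mem_univ, if_true, ← Finset.mul_sum]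
  rw [← Finset.sum_mul]
  ring

/-- `Lawler137Shape` is monotone in its constant. [folklore] -/
theorem lawler137Shape_mono {y : Pt} {K K' : ℝ} (h : Lawler137Shape y K) (hKK' : K ≤ K') : Lawler137Shape y K' :=
  fun x hx => (h x hx).trans (mul_le_mul_of_nonneg_right hKK' (Real.rpow_nonneg (Real.sqrt_nonneg _) _))

/-! ## §2. The three instances of (1.37), as theorems -/

/-- **Lawler (1.37) for `y = e_μ`, in an3's shape, PROVED** (from lit1's `latticeGreen_second_diff_continuum`,
`d = 4`): one `K ≥ 0` for all four directions. [folklore] -/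
theorem lawler137Shape_unitVec : ∃ K : ℝ, 0 ≤ K ∧ ∀ μ : Fin 4, Lawler137Shape (unitVec μ) K := by
  obtain ⟨K, hK0, hK⟩ :=
    Literature.Probability.LatticeModels.latticeGreen_second_diff_continuum (d := 4) (by norm_num)
  refine ⟨K, hK0, fun μ x hx => ?_⟩
  have h := hK x hx μ
  have e5 : -((4 : ℝ) + 1) = -5 := by norm_num
  have e6 : -((4 : ℝ) + 2) = -6 := by norm_num
  simp only [Nat.cast_ofNat] at h
  rw [e5, e6, green_const_four, sqrt_rpow_neg_four hx, sqrt_rpow_neg_six hx] at h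
  have hq : ∑ k, ∑ l, (((unitVec μ : Pt) k : ℤ) : ℝ) * (((unitVec μ : Pt) l : ℤ) : ℝ) * hessInvSq k l (toReal x) =
      8 * ((x μ : ℤ) : ℝ) ^ 2 / r2 (toReal x) ^ 3 - 2 * 1 / r2 (toReal x) ^ 2 := by
    rw [qf_hessInvSq, unitVec, Literature.Probability.LatticeModels.dot_single,
      Literature.Probability.LatticeModels.sum_sq_single]
  unfold unitVec at hq ⊢
  rw [hq]
  have e : 2 * c4 * (8 * ((x μ : ℤ) : ℝ) ^ 2 / r2 (toReal x) ^ 3 - 2 * 1 / r2 (toReal x) ^ 2) =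
      2 * c4 * ((2 - 4) * (1 / r2 (toReal x) ^ 2 - 4 * ((x μ : ℤ) : ℝ) ^ 2 * (1 / r2 (toReal x) ^ 3))) := by ring
  rw [e]
  exact h

/-- **Lawler (1.37) for `y = e_μ + e_ν` (`μ ≠ ν`), in an3's shape, PROVED** (from lit1's
`latticeGreen_second_diff_continuum_two`, `d = 4`). [folklore] -/
theorem lawler137Shape_unitVec_add :
    ∃ K : ℝ, 0 ≤ K ∧ ∀ μ ν : Fin 4, μ ≠ ν → Lawler137Shape (unitVec μ + unitVec ν) K := by
  obtain ⟨K, hK0, hK⟩ :=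
    Literature.Probability.LatticeModels.latticeGreen_second_diff_continuum_two (d := 4) (by norm_num)
  refine ⟨K, hK0, fun μ ν hμν x hx => ?_⟩
  have h := hK x hx μ ν hμν
  have e5 : -((4 : ℝ) + 1) = -5 := by norm_num
  have e6 : -((4 : ℝ) + 2) = -6 := by norm_num
  simp only [Nat.cast_ofNat] at h
  rw [e5, e6, green_const_four, sqrt_rpow_neg_four hx, sqrt_rpow_neg_six hx,
    show x + Pi.single μ 1 + Pi.single ν 1 = x + (Pi.single μ 1 + Pi.single ν 1) from add_assoc _ _ _,
    show x - Pi.single μ 1 - Pi.single ν 1 = x - (Pi.single μ 1 + Pi.single ν 1) from sub_sub _ _ _] at h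
  have hq : ∑ k, ∑ l, (((unitVec μ + unitVec ν : Pt) k : ℤ) : ℝ) * (((unitVec μ + unitVec ν : Pt) l : ℤ) : ℝ) *
        hessInvSq k l (toReal x) =
      8 * (((x μ : ℤ) : ℝ) + ((x ν : ℤ) : ℝ)) ^ 2 / r2 (toReal x) ^ 3 - 2 * 2 / r2 (toReal x) ^ 2 := by
    rw [qf_hessInvSq, unitVec, unitVec, Literature.Probability.LatticeModels.dot_single_add_single,
      Literature.Probability.LatticeModels.sum_sq_single_add_single hμν]
  unfold unitVec at hq ⊢
  rw [hq]
  have e : 2 * c4 * (8 * (((x μ : ℤ) : ℝ) + ((x ν : ℤ) : ℝ)) ^ 2 / r2 (toReal x) ^ 3 - 2 * 2 / r2 (toReal x) ^ 2) =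
      2 * c4 * ((2 - 4) * (2 * (1 / r2 (toReal x) ^ 2) -
        4 * (((x μ : ℤ) : ℝ) + ((x ν : ℤ) : ℝ)) ^ 2 * (1 / r2 (toReal x) ^ 3))) := by ring
  rw [e]
  exact h

/-- **One constant for all three instances.** [folklore] -/
theorem lawler137 : ∃ K : ℝ, 0 ≤ K ∧ (∀ μ : Fin 4, Lawler137Shape (unitVec μ) K) ∧
    ∀ μ ν : Fin 4, μ ≠ ν → Lawler137Shape (unitVec μ + unitVec ν) K := by
  obtain ⟨K₁, hK₁0, h₁⟩ := lawler137Shape_unitVec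
  obtain ⟨K₂, -, h₂⟩ := lawler137Shape_unitVec_add
  exact ⟨max K₁ K₂, le_max_of_le_left hK₁0, fun μ => lawler137Shape_mono (h₁ μ) (le_max_left _ _),
    fun μ ν hμν => lawler137Shape_mono (h₂ μ ν hμν) (le_max_right _ _)⟩

/-- The common (1.37)-constant for the step vectors `e_μ`, `e_μ + e_ν` of `ℤ⁴`. [folklore] -/
def K137 : ℝ := Classical.choose lawler137

/-- `K137 ≥ 0`. [folklore] -/
theorem K137_nonneg : 0 ≤ K137 := (Classical.choose_spec lawler137).1

/-- (1.37) for `e_μ` with the common constant. [folklore] -/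
theorem K137_unit (μ : Fin 4) : Lawler137Shape (unitVec μ) K137 := (Classical.choose_spec lawler137).2.1 μ

/-- (1.37) for `e_μ + e_ν` with the common constant. [folklore] -/
theorem K137_diag {μ ν : Fin 4} (hμν : μ ≠ ν) : Lawler137Shape (unitVec μ + unitVec ν) K137 :=
  (Classical.choose_spec lawler137).2.2 μ ν hμν

/-! ## §3. The two-derivative free leg and the `k = 0` free rung, unconditional -/

/-- **THE MIXED SECOND-DIFFERENCE FREE LEG `c₄∂_μ∂_ν|x|⁻²` (`μ ≠ ν`) at `k = 0`, UNCONDITIONAL**: an3's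
`mixedHessLeg` with its three (1.37) binders discharged by `K137_*`. [folklore] -/
def mixedHessLeg₀ {μ ν : Fin 4} (hμν : μ ≠ ν) : Leg :=
  mixedHessLeg μ ν K137_nonneg (K137_diag hμν) (K137_unit μ) (K137_unit ν)

/-- Its continuum part is `c₄∂_μ∂_ν|x|⁻²`. [folklore] -/
theorem mixedHessLeg₀_ℓ {μ ν : Fin 4} (hμν : μ ≠ ν) (x : E4) : (mixedHessLeg₀ hμν).ℓ x = c4 * hessInvSq μ ν x :=
  mixedHessLeg_ℓ hμν K137_nonneg (K137_diag hμν) (K137_unit μ) (K137_unit ν) x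

/-- Its degree is `4`. [folklore] -/
theorem mixedHessLeg₀_a {μ ν : Fin 4} (hμν : μ ≠ ν) : (mixedHessLeg₀ hμν).a = 4 := rfl

/-- **THE FREE BACKGROUND-FIELD TABLE AT `k = 0` MEETS `hval` WITH `κ = kappaBal N` — unconditionally.**
(an3's `hval_freeTable` with the shape binders discharged.)  Whether Bałaban's `k = 0` integrand reduces to this table
is NOT asserted. [folklore] -/
theorem hval_freeTable₀ {μ ν : Fin 4} (hμν : μ ≠ ν) (N : ℝ) :
    (∀ i ∈ (Finset.univ : Finset (Fin 2)),
        (![freeLeg, gradLegFwd μ] i).a + (![mixedHessLeg₀ hμν, gradLegFwd ν] i).a = 6) ∧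
      ∀ x : E4, x ≠ 0 →
        x μ * x ν * contBubble Finset.univ ![2 * N * N * 6, 2 * N * N * 10] ![freeLeg, gradLegFwd μ]
            ![mixedHessLeg₀ hμν, gradLegFwd ν] x = leadingIntegrand (kappaBal N) μ ν x :=
  hval_freeTable hμν N K137_nonneg (K137_diag hμν) (K137_unit μ) (K137_unit ν)

/-- **THE `k = 0` FREE RUNG, ASSEMBLED, WITH NO PRINTED HYPOTHESIS** (an INSTANCE of `WindowDecomposition`): for any
`β⁰`, window `M` and constants with the comparability and the outside-window slot `A₁` relative to the free
background-field table, `stepBal N L − A ≤ β⁰(L,k)` for all `L ≥ 2`, `k`, with `A` explicit in the table's constants —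
an3's `stepBal_le_of_freeTable` with `hK h₁ h₂ h₃` discharged.  INPUT NOT SUPPLIED HERE: `hA₁` (items (iii)–(v) at
`k = 0`). [folklore] -/
theorem stepBal_le_of_freeTable₀ {μ ν : Fin 4} (hμν : μ ≠ ν) {N : ℝ} (hN : N ≠ 0)
    {β0 : ℕ → ℕ → ℝ} {A₁ cc : ℝ} {M : ℕ → ℕ} (hc : 1 ≤ cc)
    (hM : ∀ L : ℕ, 2 ≤ L → 1 ≤ M L ∧ (L : ℝ) ≤ cc * M L)
    (hA₁ : ∀ L : ℕ, 2 ≤ L → ∀ k : ℕ,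
      |β0 L k - ∑ w ∈ annulus 4 0 (M L), toReal w μ * toReal w ν *
          lattBubble Finset.univ ![2 * N * N * 6, 2 * N * N * 10] ![freeLeg, gradLegFwd μ]
            ![mixedHessLeg₀ hμν, gradLegFwd ν] L k w| ≤ A₁) :
    ∀ L : ℕ, 2 ≤ L → ∀ k : ℕ,
      B12Normalization.stepBal N L - WindowDecomposition.constA (|kappaBal N| * 24 + |kappaBal N| * 110592)
        (bubbleConst Finset.univ ![2 * N * N * 6, 2 * N * N * 10] ![freeLeg, gradLegFwd μ]
          ![mixedHessLeg₀ hμν, gradLegFwd ν]) A₁ cc (kappaBal N * transverseValue) ≤ β0 L k :=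
  stepBal_le_of_freeTable hμν hN K137_nonneg (K137_diag hμν) (K137_unit μ) (K137_unit ν) hc hM hA₁

end Literature.MathematicalPhysics.QuantumFieldTheory.Balaban1983to89.Beta.FreeHessianLeg

end
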